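import Summits.Langlands.Langlands.Theses.ParityBlindBianchi
import Summits.Langlands.Langlands.Theorems.ParityBlindBianchiArtinWeightRealisationEvenStubProjectiveImageOfModel
import Summits.Langlands.Langlands.Theorems.ParityBlindBianchiArtinWeightRealisationEvenRealisationOfEventually
import Summits.Langlands.Langlands.Theorems.ParityBlindBianchiArtinWeightRealisationEvenStubAdTraceTransfer
import Summits.Langlands.Langlands.Theorems.ParityBlindBianchiArtinWeightRealisationEvenStubAdNormalFrame
import Summits.Langlands.Langlands.Theorems.ParityBlindBianchiArtinWeightRealisationEvenStubTwistOfAdNormalForm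
import Summits.Langlands.Langlands.Theorems.ParityBlindBianchiArtinWeightRealisationEvenStubTwistedRealisationFin
import Summits.Langlands.Langlands.Theorems.ParityBlindBianchiArtinWeightRealisationEvenTwistConjugateOfAdTraces
import Summits.Langlands.Langlands.Theorems.ParityBlindBianchiArtinWeightRealisationEvenClassicalOccurrenceAEFOfBianchiDeligneSerre

/-!
# Line `SketchIdeator2` (card `adjoint-unitary-host-sign-pinning`) for the crux
# `ParityBlindBianchi.ArtinWeightRealisationEven` (item stmt-Langlands-16619, R″) — SKELETON v6.1

Composition `ArtinWeightRealisationEven_of : ArtinWeightRealisationEven` BY NAME from two OPEN stubs, both in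
ALMOST-EVERYWHERE form and with the compatibility demanded of the automorphic side relaxed to ADJOINT compatibility:

* `stub_adjointHostAd` (S1ad, OPEN — the card's K1 ∧ K2 ∧ K3: automorphy of `Ad⁰σ` on a unitary/`GL₃` host,
  Griffiths–Schmid classicality on `U(2,1)`, adjoint descent `GL₃`-selfdual → `Ad(GL₂)` (Ramakrishnan 2014, in
  print), stated as their composite OUTPUT in the tree's vocabulary): the hypotheses of R″ verbatim ⇒ a cuspidal `π`
  of `GL₂(𝔸_K)` OF ARTIN TYPE which at all but finitely many places `w` is compatible with `σ` UP TO A SCALAR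
  `c_w ∈ ℂˣ` (`charpoly σ(Frob_w)` = arithmetic-Frobenius polynomial of `c_w · α_w`), i.e. `Ad π_w ↔ Ad⁰σ(Frob_w)`.
  This is strictly weaker than v5's sign-blind S1ae (`c_w = ±1`): from adjoint compatibility one can NOT twist to
  sign-blindness without solving an embedding problem (`ω_π / det σ` need not be a square among Galois characters);
  the line now absorbs that step (given `r`, the square root is `θ` with `r = θ · M σ M⁻¹`).
* `stub_classicalOccurrenceAEF` (S2aeF, OPEN — the card's K4; = direction (A) of reciprocity, a.e. Satake form
  with finite image, for the ARTIN-TYPE SECTOR of `GL₂` over imaginary quadratic fields; it follows BY NAME from the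
  three items of route BianchiDeligneSerre, `PadicAutomorphyArtinTypeK` (stmt-Langlands-15868) ∧
  `ArithmeticityArtinTypeK` (15869) ∧ `DeligneSerreTransportK` (15870), see
  `stub_classicalOccurrenceAEF_of_bianchiDeligneSerre`): every cuspidal `π` of Artin type over an imaginary
  quadratic `K` carries, for every `p` and `ι`, a finite-image framed `r : Γ_K → GL₂(ℚ̄_p)` Satake–Frobenius
  compatible with it at all but finitely many places.

and the LANDED checkable half (all `--supports stmt-Langlands-16619`, axioms propext/Classical.choice/Quot.sound):

* `stub_projectiveImageOfModel` (S7, p150704): the ι-model `σ` of `ρ|_K` keeps projective image `A₅`;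
* `stub_adTraceTransfer` (S3ad, p164501): Chebotarev transfer of the adjoint trace identity
  `tr(r g)² det σ(g) = tr(σ g)² det r(g)` from the a.e. data to all of `Γ_K`;
* `stub_adNormalFrame` (S4ad-frame, p164535) and `stub_twistOfAdNormalForm` (S4ad-twist, p164567): the
  general-twist pinning — finite images, `σ` projectively `A₅` and the adjoint trace identity force
  `r = χ · M σ M⁻¹` (composed in `twistConjugate_of_adTraces`, p165037; ELEMENTARY, dihedral normal form on `D₅ ⊂ A₅`,
  Vandermonde sign lemma with a square root `δ² = det R / det Q`, "a group is not the union of two proper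
  subgroups"; no character theory);
* `stub_twistedRealisationFin` (S5fin, p164533): twisting `π` back by the Hecke character of the finite-order `χ`
  (Artin reciprocity `artinReciprocity_character_holds`, Borel–Jacquet twist) realises `σ` at every good place
  of an enlarged `S₁`;
* `good_of_good_union_image_absNorm`, `eventually_good` (p162941): the a.e. bookkeeping; Jacquet–Langlands rigidity
  (`ArtinWeightRealisationLevel.satakeFrobCompatibleAt_of_eventually_of_isUnramifiedAt` fed with
  `frobSatakeCompatibleAt_of_isUnramifiedAt_of_archKirillovGammaProduct'` — Gelbart 1997 Prop. 4.1 /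
  Jacquet–Langlands 1970, PROVED in the tree) returns to EVERY good place, `σ` being unramified there by the first
  clause of Hansen's association in the Hecke-point hypothesis.

History.  v4 (lead -0): `R″ ⟸ S1 ∧ S7 ∧ S2 ∧ stub_pinnedRealisation`, S1/S2 at EVERY good place, S1 sign-blind.
v5 (lead c1): S1 → S1ae, S2 → S2ae (a.e.; glue `realisation_of_eventually` p162941; bridge from BianchiDeligneSerre
p163232).  v6 (lead c1): S1ae → S1ad (adjoint compatibility), S2ae → S2aeF (finite image, as BianchiDeligneSerre
delivers), general-twist pinning landed (p164501, p164535, p164567, p164533).  Repair w.r.t. the sketch: its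
`QuadraticTwistPinning` is false for `0 ∈ S₀`; `(0 : ℕ) ∉ S₀` is carried throughout (R″ has it).
-/

set_option linter.dupNamespace false

namespace Summit.Langlands.Langlands.Theorems.ArtinWeightRealisationEven

open scoped MatrixGroups Matrix Polynomial NumberField
open NumberField IsDedekindDomain Polynomial Field Filter
open Literature.NumberTheory.Automorphic Literature.NumberTheory.GaloisRepresentations

/-! ### The two OPEN stubs -/

/-- S1ad (OPEN; card K1 ∧ K2 ∧ K3, "adjoint-compatible R″ almost everywhere"): under the hypotheses of R″ verbatim,
some cuspidal `π` of `GL₂(𝔸_K)` OF ARTIN TYPE is, at all but finitely many places `w`, compatible with `σ` UP TO A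
SCALAR: `charpoly σ(Frob_w)` is the arithmetic-Frobenius polynomial of `c_w · α_w` for the Satake parameter `α_w` of
`π_w` and some `c_w ∈ ℂˣ` — equivalently `Ad π_w ↔ Ad⁰σ(Frob_w)`.  (Sign-blind = the case `c_w = ±1`; a general
`c_w` is what adjoint descent from `U(3)`/`GL₃` can be expected to deliver, the central character being invisible
to `Ad⁰`.) -/
theorem stub_adjointHostAd :
    ∀ (p : ℕ) [Fact p.Prime] (ι : PadicAlgCl p ≃+* ℂ) (ρ : Literature.NumberTheory.GaloisRepresentations.FramedGaloisRep ℚ ℂ 2), ρ.toGaloisRep.IsIrreducible → Nonempty ((Matrix.ProjGenLinGroup.mk.comp ρ.toMonoidHom).range ≃* alternatingGroup (Fin 5)) → (∀ (φ : ℚ →+* ℝ) (c : Field.absoluteGaloisGroup ℚ), Literature.NumberTheory.GaloisRepresentations.IsComplexConjugation φ c → Matrix.GeneralLinearGroup.det (ρ c) = 1) → ∀ (K : Type) [Field K] [NumberField K], NumberField.IsTotallyComplex K → Module.finrank ℚ K = 2 → ∀ (σ : Literature.NumberTheory.GaloisRepresentations.FramedGaloisRep K (PadicAlgCl p) 2),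 (∀ (g : Field.absoluteGaloisGroup K) (i j : Fin 2), ι ((σ g).val i j) = ((Literature.NumberTheory.GaloisRepresentations.FramedGaloisRep.restrictField K ρ) g).val i j) → Finite σ.toMonoidHom.range → σ.toGaloisRep.IsIrreducible → ∀ S₀ : Finset ℕ, p ∈ S₀ → (0 : ℕ) ∉ S₀ → (∃ (U : Subgroup (GL (Fin 2) (IsDedekindDomain.FiniteAdeleRing (NumberField.RingOfIntegers K) K))) (ϖ : ∀ v : IsDedekindDomain.HeightOneSpectrum (NumberField.RingOfIntegers K), (v.adicCompletion K)ˣ) (a : {v : IsDedekindDomain.HeightOneSpectrum (NumberField.RingOfIntegers K) // ∀ ℓ ∈ S₀, ((ℓ : ℕ) : NumberField.RingOfIntegers K) ∉ v.asIdeal} → ℕ → (Valued.v (R := PadicAlgCl p)).valuationSubring), IsOpen (U : Set (GL (Fin 2) (IsDedekindDomain.FiniteAdeleRing (NumberField.RingOfIntegers K) K))) ∧ U ≤ Literature.NumberTheory.Automorphic.glFiniteIntegralLevel 2 K ∧ (∀ g ∈ Literature.NumberTheory.Automorphic.glFiniteIntegralLevel 2 K, (∀ v : IsDedekindDomain.HeightOneSpectrum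 (NumberField.RingOfIntegers K), ¬ (∀ ℓ ∈ S₀, ((ℓ : ℕ) : NumberField.RingOfIntegers K) ∉ v.asIdeal) → ∀ i j : Fin 2, ((g : Matrix (Fin 2) (Fin 2) (IsDedekindDomain.FiniteAdeleRing (NumberField.RingOfIntegers K) K)) i j) v = (1 : Matrix (Fin 2) (Fin 2) (v.adicCompletion K)) i j) → g ∈ U) ∧ (∀ v : IsDedekindDomain.HeightOneSpectrum (NumberField.RingOfIntegers K), Valued.v ((ϖ v : (v.adicCompletion K)ˣ) : v.adicCompletion K) = WithZero.exp (-1 : ℤ)) ∧ Literature.NumberTheory.Automorphic.IsHeckePoint (Matrix.GeneralLinearGroup.map (n := Fin 2) (algebraMap K (IsDedekindDomain.FiniteAdeleRing (NumberField.RingOfIntegers K) K))) (Literature.NumberTheory.Automorphic.LevelTower.ofSeq U (fun r : ℕ => (Literature.NumberTheory.Automorphic.principalCongruenceLevel 2 K (Ideal.span {((p : ℕ) : NumberField.RingOfIntegers K)} ^ r)).map (Literature.NumberTheory.Automorphic.GLn.sndHom 2 K))) ((p : ℕ) : (Valued.v (R := PadicAlgCl p)).valuationSubring) (fun j : {v :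 IsDedekindDomain.HeightOneSpectrum (NumberField.RingOfIntegers K) // ∀ ℓ ∈ S₀, ((ℓ : ℕ) : NumberField.RingOfIntegers K) ∉ v.asIdeal} × Fin 2 => Literature.NumberTheory.Automorphic.GLn.sndHom 2 K (Literature.NumberTheory.Automorphic.heckeDiagAt 2 K j.1.1 (ϖ j.1.1) (j.2.val + 1))) (fun j => a j.1 (j.2.val + 1)) ∧ ∀ (v : IsDedekindDomain.HeightOneSpectrum (NumberField.RingOfIntegers K)) (hv : ∀ ℓ ∈ S₀, ((ℓ : ℕ) : NumberField.RingOfIntegers K) ∉ v.asIdeal), σ.IsHeckeAssociatedAt v (fun i : ℕ => if i = 0 then (1 : PadicAlgCl p) else ((a ⟨v, hv⟩ i : (Valued.v (R := PadicAlgCl p)).valuationSubring) : PadicAlgCl p))) → ∃ (hcpt : Literature.NumberTheory.Automorphic.isCompact_glFiniteIntegralLevel 2 K) (π : Literature.NumberTheory.Automorphic.CuspidalAutomorphicRepData 2 K hcpt), (∃ T : Literature.NumberTheory.Automorphic.InfinityType K 2, π.1.HasInfinityType T ∧ ∀ τ : K →+* ℂ, ∀ x ∈ T τ, x.a = 0 ∧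 x.b = 0) ∧ ∀ᶠ w : IsDedekindDomain.HeightOneSpectrum (NumberField.RingOfIntegers K) in Filter.cofinite, ∃ α : Multiset ℂ, π.1.HasSatakeParamAt w α ∧ ∃ c : ℂ, c ≠ 0 ∧ σ.HasFrobCharpolyAt w (Literature.NumberTheory.Automorphic.arithFrobPolyOfSatake ι w.residueCard 1 (α.map (c * ·))) := by
  sorry

/-- S2aeF (OPEN; card K4 — direction (A), a.e. Satake form WITH FINITE IMAGE, for the Artin-type sector of `GL₂`
over imaginary quadratic fields; follows by name from the items stmt-Langlands-15868/15869/15870 of route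
BianchiDeligneSerre, whose transported Deligne–Serre engine outputs exactly a finite-image `r`): a cuspidal `π` of
`GL₂(𝔸_K)` of Artin type, `K` imaginary quadratic, carries for every `p` and `ι : ℚ̄_p ≃ ℂ` a framed
`r : Γ_K → GL₂(ℚ̄_p)` with finite image, Satake–Frobenius compatible with `π` at all but finitely many places. -/
theorem stub_classicalOccurrenceAEF :
    ∀ (K : Type) [Field K] [NumberField K], NumberField.IsTotallyComplex K → Module.finrank ℚ K = 2 → ∀ (hcpt : isCompact_glFiniteIntegralLevel 2 K) (π : CuspidalAutomorphicRepData 2 K hcpt), (∃ T : InfinityType K 2, π.1.HasInfinityType T ∧ ∀ τ : K →+* ℂ, ∀ x ∈ T τ, x.a = 0 ∧ x.b = 0) → ∀ (p : ℕ) [Fact p.Prime] (ι : PadicAlgCl p ≃+* ℂ), ∃ r : FramedGaloisRep K (PadicAlgCl p) 2, Finite r.toMonoidHom.range ∧ ∀ᶠ w : HeightOneSpectrum (𝓞 K) in Filter.cofinite, SatakeFrobCompatibleAt ι π.1 r w := by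
  sorry

/-! ### The composition -/

/-- **The composition of the line** (`SketchIdeator2`, skeleton v6): S1ad ∧ S2aeF ∧ S3ad ∧ S4ad-frame ∧ S4ad-twist
∧ S5fin ∧ S7 ⊢ R″ BY NAME (S3ad p164501, S4ad-frame p164535, S4ad-twist p164567, S5fin p164533, S7 p150704 and the
`a.e.` bookkeeping of p162941 are LANDED and imported; the two remaining `sorry`s are the OPEN stubs S1ad and S2aeF; Jacquet–Langlands rigidity is the tree theorem
`ArtinWeightRealisationLevel.satakeFrobCompatibleAt_of_eventually_of_isUnramifiedAt` fed with
`frobSatakeCompatibleAt_of_isUnramifiedAt_of_archKirillovGammaProduct'`). -/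
theorem ArtinWeightRealisationEven_of :
    Summit.Langlands.Langlands.Theses.ParityBlindBianchi.ArtinWeightRealisationEven := by
  intro p _ ι ρ hρirr hρA5 hρeven K _ _ hKtc hK2 σ hmodel hσfin hσirr S₀ hpS₀ h0S₀ hHecke
  -- `σ` is unramified at every good place (first clause of Hansen's association at the Hecke point)
  have hunr : ∀ w : HeightOneSpectrum (𝓞 K), (∀ ℓ ∈ S₀, ((ℓ : ℕ) : 𝓞 K) ∉ w.asIdeal) →
      σ.IsUnramifiedAt w := by
    obtain ⟨U, ϖ, a, -, -, -, -, -, hassoc⟩ := hHecke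
    exact fun w hw => (hassoc w hw).isUnramifiedAt
  -- S1ad: the adjoint-compatible realisation almost everywhere
  obtain ⟨hcpt, π, hAT, hπ⟩ :=
    stub_adjointHostAd p ι ρ hρirr hρA5 hρeven K hKtc hK2 σ hmodel hσfin hσirr S₀ hpS₀ h0S₀ hHecke
  -- S7: projective image of σ
  have hσA5 := stub_projectiveImageOfModel p ι ρ hρA5 K hK2 σ hmodel
  -- S2aeF: a finite-image Galois representation attached to π almost everywhere
  obtain ⟨r, hrfin, hr⟩ := stub_classicalOccurrenceAEF K hKtc hK2 hcpt π hAT p ι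
  -- S3ad: the adjoint trace identity on all of Γ_K
  have had := stub_adTraceTransfer K p ι σ r hcpt π (hπ.and hr)
  -- S4ad: twist-conjugacy `r = χ · M σ M⁻¹`, `χ` of finite order
  haveI : Finite σ.toMonoidHom.range := hσfin
  haveI : Finite r.toMonoidHom.range := hrfin
  obtain ⟨χ, M, hχ⟩ := twistConjugate_of_adTraces (absoluteGaloisGroup K) (PadicAlgCl p)
    σ.toMonoidHom r.toMonoidHom hσfin hrfin hσA5 had
  have hχfin := finite_range_of_twistConjugate σ.toMonoidHom r.toMonoidHom hσfin hrfin χ M hχ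
  -- enlarge `S₀` past the exceptional places of `r`, twist back there (S5fin) …
  obtain ⟨S₁, h01, -, hgood⟩ :=
    good_of_good_union_image_absNorm K S₀ h0S₀ _ (Filter.eventually_cofinite.mp (hπ.and hr))
  obtain ⟨hcpt', π', hπ'⟩ := stub_twistedRealisationFin K p ι σ r χ M hχfin hχ S₁ hcpt π (fun w hw => by
    obtain ⟨hw0, hwE⟩ := hgood w hw
    exact ⟨hunr w hw0, (Classical.not_not.mp hwE).2⟩)
  -- … and return to EVERY good place by Jacquet–Langlands rigidity
  refine ⟨hcpt', π', fun w hw => ?_⟩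
  exact ArtinWeightRealisationLevel.satakeFrobCompatibleAt_of_eventually_of_isUnramifiedAt
    frobSatakeCompatibleAt_of_isUnramifiedAt_of_archKirillovGammaProduct' K p ι σ hσfin hcpt' π'
    ((eventually_good K S₁ h01).mono hπ') w (hunr w hw)

end Summit.Langlands.Langlands.Theorems.ArtinWeightRealisationEven
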